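import Mathlib
import HarnessLib
import Literature.MathematicalPhysics.StatisticalMechanics.TunedInitialConditionTorusFRDFull
import Literature.Dynamics.Hyperbolic.RGFlowStableManifoldInvariant
import Summits.HubbardSuperconductivity.HubbardSuperconductivity.Theorems.ComplexGFFStiffnessHypACumulantIotaStep
import Summits.HubbardSuperconductivity.HubbardSuperconductivity.Theorems.ComplexGFFStiffnessHypACumulantIotaSubspaces

/-!
# Crux `HypACumulant`, line `gnv` — [ABKM19] Lemma 12.6 on the `ι`-SYMMETRIC class: the tuned initial
# relevant Hamiltonian `ℋ⋆ = Π_{H_0} Ẑ(𝒦, ℋ⋆)` is an `ι`-Hamiltonian (REAL quadratic part)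

Route `route-HubbardSuperconductivity-ComplexGFFStiffness`, crux items stmt-HubbardSuperconductivity-19154 /
-19155, research stub `stub_gnvOfFrd : TorusFRD 4 → GNV`.  The crux's stated risk is that the fine-tuned
quadratic form of Ch. 12 could become complex for a complex perturbation.  This file settles that risk for
the torus data: `Literature/…/TunedInitialConditionTorusFRDFull` gives Lemma 12.6 (Brouwer) for the steps
`(rgA, rgBT, rgSQ)` and the initial activity `initAct 𝒦`; `Literature/Dynamics/Hyperbolic/RGFlowStableManifoldInvariant`
runs the same argument INSIDE invariant closed subspaces; and `…HypACumulantIotaStep` shows that every map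
preserves the `ι`-symmetric classes (`IsIotaHam`: real constant/quadratic, imaginary linear coefficients;
`IsIotaFun`: `K(X,−φ) = conj K(X,φ)`).  Hence:

* `iotaSub`, `iotaActSub` — the `ι`-symmetric relevant Hamiltonians as a real submodule of `HamSpace ℂ`,
  the `ι`-symmetric admissible activities as a subgroup of `activitySpace`;
* `isIotaHam_stepOpA` / `isIotaHam_stepOpAInv`, `isIotaFun_mulExt`, `isIotaFun_restrictConn` — closure;
* **`exists_tuned_initial_iota_of_torusFRD_of_hl`**, **`exists_tuned_initial_iota_of_torusFRD`** — for an
  `ι`-symmetric perturbation `𝒦(−z) = conj 𝒦(z)` the tuned `ℋ⋆` of Lemma 12.6 can be taken with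
  `IsIotaHam ℋ⋆`; in particular its quadratic coefficients are REAL, so `q(ℋ⋆)` is a genuine Gaussian
  tuning parameter for the representation of Ch. 4.

Honest scope: this is the fine tuning on the symmetric class; the representation of `𝒵_N` with the tuned
Gaussian and the final non-vanishing (`GNV`) are not here.  All proved; no `sorry`.

## References
* S. Adams, S. Buchholz, R. Kotecký, S. Müller, arXiv:1910.13564, Lemma 12.6, Ch. 4, Definition 6.5
  [AdamsBuchholzKoteckyMuller2019].
-/

noncomputable section

-- `Summit.<Summit>.<Problem>`: single-conjunct summit, the duplicate component is mandated (D-0017).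
set_option linter.dupNamespace false

namespace Summit.HubbardSuperconductivity.HubbardSuperconductivity.Theorems.ComplexGFF

open scoped BigOperators ComplexConjugate
open Real Set Finset MeasureTheory
open Literature.MathematicalPhysics.StatisticalMechanics.GradientRG
open Literature.MathematicalPhysics.StatisticalMechanics.GradientFRD
  (fourierCoeff cExt cExt_of_mem IsElliptic IsUnitSymm InShell iterDiff supNorm conv ellOp isElliptic_one)
open Literature.MathematicalPhysics.StatisticalMechanics.TorusPolymer
  (IsPolymer numBlocks blockOf boxCorner isPolymer_blockOf isConn_blockOf)
open Literature.Barriers.CriticalPhenomena.LongRangePhi4.Polymer (IsConn components)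
open Literature.MathematicalPhysics.QuantumFieldTheory
open Literature.Dynamics.Hyperbolic

variable {d M : ℕ} [NeZero M]

/-! ## Lemma 12.6 on the `ι`-symmetric class -/

section Package

variable {L N Mord R n ñ : ℕ} {θbar lam μ δ₁ δ₀ A𝒫 : ℝ}
    {𝒞 : Matrix (Fin d) (Fin d) ℝ → ℕ → (Fin d → ZMod M) → ℝ} {Mc : ℕ → ℝ}
    {Cα : (Fin d → ℕ) → ℕ → ℝ} {c C : ℝ} {Cℓ : ℕ → ℝ}

set_option maxHeartbeats 1600000 in
/-- **[ABKM19] Lemma 12.6 on the `ι`-symmetric class, given (12.53)**: as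
`exists_tuned_initial_of_torusFRD`, for an `ι`-symmetric perturbation `𝒦`, with the extra conclusion
`IsIotaHam ℋ⋆` (real quadratic part of the tuned initial Hamiltonian). -/
theorem exists_tuned_initial_iota_of_torusFRD_of_hl {h : ℝ} [Fact (0 < h)] [Fact (0 < L)]
    (hd : 3 ≤ d) (hMord : 1 ≤ Mord) (hMR : Mord ≤ R) (hLodd : Odd L) (hL : 2 ^ (d + 3) + 16 * R ≤ L)
    (hR2 : 2 ≤ R) (hM : M = L ^ N)
    (hθbar : 0 < θbar) (hlam : 0 < lam) (hn : 2 * Mord ≤ n) (hn2 : 2 ≤ n) (hnñ : n ≤ ñ)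
    (hc : 0 < c) (hC1 : 0 ≤ Cℓ 1)
    (hallA : ∀ A : Matrix (Fin d) (Fin d) ℝ, IsElliptic (1 / 2 : ℝ) 2 A →
        (∀ k, 1 ≤ k → k ≤ N + 1 →
          ∑ x : Fin d → ZMod M, 𝒞 A k x = 0 ∧ ∀ x, 𝒞 A k (-x) = 𝒞 A k x) ∧
        (∀ k, 1 ≤ k → k ≤ N + 1 → ∀ φ : (Fin d → ZMod M) → ℝ, ∑ x, φ x = 0 →
          0 ≤ ∑ x, ∑ y, φ x * 𝒞 A k (x - y) * φ y) ∧
        (∀ φ : (Fin d → ZMod M) → ℝ, ∑ x, φ x = 0 →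
          ellOp A (conv (fun x => ∑ k ∈ Finset.Icc 1 (N + 1), 𝒞 A k x) φ) = φ) ∧
        (∀ k, 1 ≤ k → k ≤ N → Mc k ≤ 0 ∧
          ∀ x : Fin d → ZMod M, ((L : ℝ) ^ k) / 2 ≤ (supNorm x : ℝ) →
            𝒞 A k x = Mc k) ∧
        (∀ k, 1 ≤ k → k ≤ N + 1 → ∀ B : Matrix (Fin d) (Fin d) ℝ, IsUnitSymm B →
          (∃ ε : ℝ, 0 < ε ∧ ∀ x : Fin d → ZMod M,
            ContDiffOn ℝ ⊤ (fun s : ℝ => 𝒞 (A + s • B) k x) (Set.Ioo (-ε) ε)) ∧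
          ∀ α : Fin d → ℕ, ∑ i, α i ≤ n → ∀ ℓ : ℕ, ∀ x : Fin d → ZMod M,
            abs (iteratedDeriv ℓ (fun s : ℝ => iterDiff α (𝒞 (A + s • B) k) x) 0)
              ≤ Cα α ℓ / (L : ℝ) ^ ((k - 1) * (d - 2 + ∑ i, α i))) ∧
        (∀ k, 1 ≤ k → k ≤ N + 1 → ∀ j : ℕ, ∀ κ : Fin d → ZMod M, κ ≠ 0 → InShell L j κ →
          (j < k →
            c / (L : ℝ) ^ (2 * (d + ñ) + 1) * (L : ℝ) ^ (2 * j)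
                / (L : ℝ) ^ ((k - j) * (d - 1 + n)) ≤ (fourierCoeff (𝒞 A k) κ).re ∧
            ‖fourierCoeff (𝒞 A k) κ‖
              ≤ C * (L : ℝ) ^ (2 * (d + ñ) + 1) * (L : ℝ) ^ (2 * j)
                  / (L : ℝ) ^ ((k - j) * (d - 1 + n))) ∧
          (k ≤ j →
            c / (L : ℝ) ^ (2 * (d + ñ) + 1) * (L : ℝ) ^ (2 * k)
                ≤ (fourierCoeff (𝒞 A k) κ).re ∧
            ‖fourierCoeff (𝒞 A k) κ‖ ≤ C * (L : ℝ) ^ (2 * k)) ∧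
          ∀ B : Matrix (Fin d) (Fin d) ℝ, IsUnitSymm B → ∀ ℓ : ℕ, 1 ≤ ℓ →
            (j < k →
              ‖iteratedDeriv ℓ (fun s : ℝ => fourierCoeff (𝒞 (A + s • B) k) κ) 0‖
                ≤ Cℓ ℓ * (L : ℝ) ^ (2 * (d + ñ) + 1) * (L : ℝ) ^ (2 * j)
                    / (L : ℝ) ^ ((k - j) * (d - 1 + ñ))) ∧
            (k ≤ j →
              ‖iteratedDeriv ℓ (fun s : ℝ => fourierCoeff (𝒞 (A + s • B) k) κ) 0‖
                ≤ Cℓ ℓ * (L : ℝ) ^ (2 * k))))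
    (hB : AbkmWeightBounds L N Mord R n θbar lam μ δ₁ δ₀ A𝒫 (fun j => 𝒞 1 j)
      (abkmWeightData L N Mord R θbar (schedDelta δ₀ δ₁ N) fun j => 𝒞 1 j))
    {pT r₀ : ℕ} (hp : d / 2 + 2 ≤ pT) (hpM : pT + d ≤ Mord) (hr₀ : 3 ≤ r₀)
    (hδ₀ : 0 < δ₀) (hδ₁ : 0 < δ₁) (hh0 : hZeroSq d R δ₀ δ₁ ≤ h ^ 2)
    (hh2 : secondDiffConst (fun θ' => Cα θ' 0) ≤ h ^ 2)
    -- the tuning ball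
    {θ : ℝ} (hθ0 : 0 ≤ θ) (hθ : θ < θbar)
    {T₀ : ℝ} (hT₀ : T₀ ≤ 1 / 2) (hKT₀ : shellRatioConst c (Cℓ 1) (L : ℝ) d ñ * T₀ ≤ Real.log (1 + θ))
    {A𝒫' : ℝ} (hA𝒫' : weightIntConstRho θbar θ (traceConst d Mord R lam (derivSum d n fun θ' _ => Cα θ' 0)) = A𝒫')
    -- the side conditions of Theorem 6.8 (`RGStepABKMQ`), at `A_𝒫' = A_𝒫(θ)`
    {A : ℝ} (hA1 : 1 ≤ A) (hA𝒫A : A𝒫' ≤ A)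
    (hsmall : (2 : ℝ) ^ (L ^ d) * (A𝒫' * A ^ (-(1 - (1 + 1 / ((2 * (2 ^ d + 1) + 6 : ℝ) ^ d))⁻¹) : ℝ)) ≤ 1)
    {r : ℝ} (hr0 : 0 ≤ r) (hr : r ≤ 1 / 64)
    (hv : vABKM d R A A𝒫' r ≤ 1 / 64) (hωA : omegaABKM d R A A𝒫' r * A ^ 2 ≤ 1)
    (hc3A : (kappaABKM d R A A𝒫' r) ^ (L ^ d) * ((2 * (2 * (kappaABKM d R A A𝒫' r) * max 1 A𝒫')) ^ ((2 ^ (d + 1) + 2) ^ d * L ^ d) * (4 : ℝ) ^ ((2 ^ (d + 1) + 2) ^ d * L ^ d)) ≤ A ^ ((1 + 1 / ((2 * (2 ^ d + 1) + 6 : ℝ) ^ d)) - 1 : ℝ))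
    (hc2A : (kappaABKM d R A A𝒫' r) ^ (L ^ d) * ((2 * (kappaABKM d R A A𝒫' r) * max 1 A𝒫') ^ ((2 ^ (d + 1) + 2) ^ d * L ^ d) * (2 : ℝ) ^ ((2 ^ (d + 1) + 2) ^ d * L ^ d)) ≤ A ^ ((1 + 1 / ((2 * (2 ^ d + 1) + 6 : ℝ) ^ d)) - 1 : ℝ))
    -- the contraction regime of Ch. 12
    {η κ ε ρ : ℝ} (hη : 0 < η) (hη1 : η ≤ 1)
    (hκ₁ : (3 / 4 : ℝ) * (η + (L : ℝ) ^ d * (pi2BoundConst d (((2 * R + 2 : ℕ) : ℝ) + ((d / 2 + 1 : ℕ) : ℝ)) * (A𝒫' * A⁻¹))) ≤ κ)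
    (hκ₂ : sigmaABKM d L R A A𝒫' r ≤ κ * η) (hκ : κ < 1)
    (hε : 0 ≤ ε) (hεr : ε ≤ r) (hερ : ε ≤ ρ) (hρ16 : ρ ≤ 1 / 16)
    -- the initial perturbation
    {𝒦 : (Fin d → ℝ) → ℂ} {ρ𝒦 : ℝ} (h𝒦 : ContDiff ℝ r₀ 𝒦)
    (h𝒦b : ∀ s, s ≤ r₀ → ∀ z : Fin d → ℝ, ‖iteratedFDeriv ℝ s 𝒦 z‖ ≤ ρ𝒦 * Real.exp ((∑ i, z i ^ 2) / 4))
    (h𝒦small : (Real.exp (1 / 4) + 2 * Real.exp (3 / 8)) *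
      (ρ𝒦 * Real.exp (fieldWt h (L : ℝ) d 0 / (L : ℝ) ^ 0)) * A ≤ 1 / 2)
    (h𝒦ε : Real.exp (1 / 4) * (ρ𝒦 * Real.exp (fieldWt h (L : ℝ) d 0 / (L : ℝ) ^ 0)) * A ≤ ε)
    (h𝒦ι : ∀ z, 𝒦 (-z) = conj (𝒦 z))
    -- the tuning map
    (qmap : HamSpace ℂ d (fieldWt h (L : ℝ) d 0) ((L : ℝ) ^ 0) (L ^ (d * 0)) → Matrix (Fin d) (Fin d) ℝ)
    (hqsymm : ∀ x, (qmap x).IsSymm) (hqT : ∀ x, ∑ i, ∑ j, |qmap x i j| ≤ T₀)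
    {Lq : ℝ} (hLq : 0 ≤ Lq)
    (hqlip : ∀ x x', ‖x‖ ≤ ρ → ‖x'‖ ≤ ρ → ∑ i, ∑ j, |(qmap x - qmap x') i j| ≤ Lq * ‖x - x'‖)
    -- (12.53): the `S_k`-comparison in the tuning parameter (HYPOTHESIS)
    {lT : ℝ} (hlT : 0 ≤ lT)
    (hl : ∀ (q q' : Matrix (Fin d) (Fin d) ℝ), q.IsSymm → q'.IsSymm →
      ∑ i, ∑ j, |q i j| ≤ T₀ → ∑ i, ∑ j, |q' i j| ≤ T₀ → ∀ k, k + 1 ≤ N →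
      ∀ (u : HamSpace ℂ d (fieldWt h (L : ℝ) d k) ((L : ℝ) ^ k) (L ^ (d * k)))
        (v : activitySpace (abkmNormParams L N Mord R pT r₀ h θbar A (schedDelta δ₀ δ₁ N) fun j => 𝒞 1 j) k)
        (cv : ℝ), ‖u‖ ≤ r →
        activityNormLE (abkmNormParams L N Mord R pT r₀ h θbar A (schedDelta δ₀ δ₁ N) fun j => 𝒞 1 j) k v cv →
        cv ≤ r →
        activityNormLE (abkmNormParams L N Mord R pT r₀ h θbar A (schedDelta δ₀ δ₁ N) fun j => 𝒞 1 j) (k + 1)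
          (rgSQ (L := L) (N := N) (Mord := Mord) (R := R) (p := pT) (r₀ := r₀) (h := h) (θbar := θbar) (A := A)
              (δ₀ := δ₀) (δ₁ := δ₁) (𝒞 := fun j => 𝒞 1 j) (fun j => 𝒞 ((1 : Matrix (Fin d) (Fin d) ℝ) + q) j) k u v -
            rgSQ (L := L) (N := N) (Mord := Mord) (R := R) (p := pT) (r₀ := r₀) (h := h) (θbar := θbar) (A := A)
              (δ₀ := δ₀) (δ₁ := δ₁) (𝒞 := fun j => 𝒞 1 j) (fun j => 𝒞 ((1 : Matrix (Fin d) (Fin d) ℝ) + q') j) k u v)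
          (lT * (∑ i, ∑ j, |(q - q') i j|) * max ‖u‖ cv)) :
    ∃ x₀ : HamSpace ℂ d (fieldWt h (L : ℝ) d 0) ((L : ℝ) ^ 0) (L ^ (d * 0)), IsIotaHam (HamSpace.toHam x₀) ∧ ‖x₀‖ ≤ ρ ∧
      ∃ x : ∀ k, HamSpace ℂ d (fieldWt h (L : ℝ) d k) ((L : ℝ) ^ k) (L ^ (d * k)),
        RGFlow.IsTunedQ (E := fun k => HamSpace ℂ d (fieldWt h (L : ℝ) d k) ((L : ℝ) ^ k) (L ^ (d * k)))
            (F := fun k => activitySpace (abkmNormParams L N Mord R pT r₀ h θbar A (schedDelta δ₀ δ₁ N) fun j => 𝒞 1 j) k)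
            N (rgA L h (fun j => 𝒞 ((1 : Matrix (Fin d) (Fin d) ℝ) + qmap x₀) j))
            (rgBT hd hMord hMR hLodd hL hM hθbar hlam hn hn2 hnñ hc hC1 hallA hB pT r₀ hr₀ A hθ0 hθ hT₀ hKT₀ (qmap x₀))
            (rgSQ (L := L) (N := N) (Mord := Mord) (R := R) (p := pT) (r₀ := r₀) (h := h) (θbar := θbar) (A := A)
              (δ₀ := δ₀) (δ₁ := δ₁) (𝒞 := fun j => 𝒞 1 j) (fun j => 𝒞 ((1 : Matrix (Fin d) (Fin d) ℝ) + qmap x₀) j))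
            (initAct (N := N) (Mord := Mord) (R := R) (p := pT) (r₀ := r₀) (θbar := θbar) (A := A) (δ₀ := δ₀)
              (δ₁ := δ₁) (𝒞 := fun j => 𝒞 1 j) 𝒦 x₀) x ∧
          RGFlow.InTubeQ (E := fun k => HamSpace ℂ d (fieldWt h (L : ℝ) d k) ((L : ℝ) ^ k) (L ^ (d * k)))
            (F := fun k => activitySpace (abkmNormParams L N Mord R pT r₀ h θbar A (schedDelta δ₀ δ₁ N) fun j => 𝒞 1 j) k)
            N η ε (activityNormLE (abkmNormParams L N Mord R pT r₀ h θbar A (schedDelta δ₀ δ₁ N) fun j => 𝒞 1 j))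
            (rgSQ (L := L) (N := N) (Mord := Mord) (R := R) (p := pT) (r₀ := r₀) (h := h) (θbar := θbar) (A := A)
              (δ₀ := δ₀) (δ₁ := δ₁) (𝒞 := fun j => 𝒞 1 j) (fun j => 𝒞 ((1 : Matrix (Fin d) (Fin d) ℝ) + qmap x₀) j))
            (initAct (N := N) (Mord := Mord) (R := R) (p := pT) (r₀ := r₀) (θbar := θbar) (A := A) (δ₀ := δ₀)
              (δ₁ := δ₁) (𝒞 := fun j => 𝒞 1 j) 𝒦 x₀) x ∧
          x 0 = x₀ := by
  have hh : 0 < h := Fact.out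
  have hd2 : 2 ≤ d := by omega
  have hA0 : 0 < A := by linarith
  set P := abkmNormParams L N Mord R pT r₀ h θbar A (schedDelta δ₀ δ₁ N) fun j => 𝒞 1 j with hP
  have hPA : 0 < P.A := hA0
  set 𝒞s : Matrix (Fin d) (Fin d) ℝ → ℕ → (Fin d → ZMod M) → ℝ :=
    fun q j => 𝒞 ((1 : Matrix (Fin d) (Fin d) ℝ) + q) j with h𝒞s
  set ball : Set (Matrix (Fin d) (Fin d) ℝ) := {q | q.IsSymm ∧ ∑ i, ∑ j, |q i j| ≤ T₀} with hball
  set dist : Matrix (Fin d) (Fin d) ℝ → Matrix (Fin d) (Fin d) ℝ → ℝ :=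
    fun q q' => ∑ i, ∑ j, |(q - q') i j| with hdist
  have hA𝒫0 : 0 ≤ A𝒫' := by
    rw [← hA𝒫']
    exact zero_le_one.trans (one_le_weightIntConstRho hθbar hθ0 hθ
      (traceConst_nonneg d Mord R hlam.le (derivSum_nonneg d n _)))
  set C87 := pi2BoundConst d (((2 * R + 2 : ℕ) : ℝ) + ((d / 2 + 1 : ℕ) : ℝ)) with hC87def
  have hC87 : 0 ≤ C87 := pi2BoundConst_nonneg d (by positivity)
  have hβ : 0 ≤ (L : ℝ) ^ d * (C87 * (A𝒫' * A⁻¹)) := by positivity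
  -- `hb` at the tuning-parameter level
  obtain ⟨bT, hbT0, hbT⟩ := exists_norm_rgBQ_sub_le_of_torusFRD (h := h) hd hMord hMR hLodd hL hM hθbar hlam hn hn2
    hnñ hc hC1 hallA hB hpM hr₀ hA1 hθ0 hθ hT₀ hKT₀ (pT := pT)
  -- the predicates
  have hQ : RGFlow.IsSubaddNormBound (F := fun k => activitySpace P k) (activityNormLE P) :=
    isSubaddNormBound_activityNormLE P hPA
  have hQnn : ∀ k, k < N → ∀ (v : activitySpace P k) (cv : ℝ), activityNormLE P k v cv → 0 ≤ cv := by
    intro k hk v cv hv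
    have hMt : M = P.L ^ k * L ^ (N - k) := by
      show M = L ^ k * L ^ (N - k)
      rw [hM, ← pow_add, Nat.add_sub_cancel' (by omega)]
    exact nonneg_of_weakNormLE hPA hMt hLodd.pow hLodd.pow hv
  have hρ8 : ρ ≤ 1 / 8 := hρ16.trans (by norm_num)
  -- apply the parametrised Lemma 12.6
  have hmain := RGFlow.exists_isTunedQ_initial_eq_of_invariant
    (E := fun k => HamSpace ℂ d (fieldWt h (L : ℝ) d k) ((L : ℝ) ^ k) (L ^ (d * k)))
    (F := fun k => activitySpace P k) (Q := activityNormLE P)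
    (A := fun q => rgA L h (𝒞s q))
    (B := fun q => rgBT hd hMord hMR hLodd hL hM hθbar hlam hn hn2 hnñ hc hC1 hallA hB pT r₀ hr₀ A hθ0 hθ hT₀ hKT₀ q)
    (S := fun q => rgSQ (L := L) (N := N) (Mord := Mord) (R := R) (p := pT) (r₀ := r₀) (h := h) (θbar := θbar)
      (A := A) (δ₀ := δ₀) (δ₁ := δ₁) (𝒞 := fun j => 𝒞 1 j) (𝒞s q))
    (y₀ := initAct (N := N) (Mord := Mord) (R := R) (p := pT) (r₀ := r₀) (θbar := θbar) (A := A) (δ₀ := δ₀)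
      (δ₁ := δ₁) (𝒞 := fun j => 𝒞 1 j) 𝒦)
    (r := r) (α := 3 / 4) (β := (L : ℝ) ^ d * (C87 * (A𝒫' * A⁻¹))) (σ := sigmaABKM d L R A A𝒫' r)
    (η := η) (κ := κ) (ε := ε) (ρ := ρ)
    (a₁ := (secondDiffConst (fun α => Cα α 1) + 1) / (4 * h ^ 2)) (b₁ := bT) (l₁ := lT)
    (m₀ := 16 * Real.exp (3 / 8) * (ρ𝒦 * Real.exp (fieldWt h (L : ℝ) d 0 / (L : ℝ) ^ 0)) * A)
    (c₀ := Real.exp (1 / 4) * (ρ𝒦 * Real.exp (fieldWt h (L : ℝ) d 0 / (L : ℝ) ^ 0)) * A) (Lq := Lq)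
    dist ball qmap (fun k => iotaSub (d := d) (fieldWt h (L : ℝ) d k) ((L : ℝ) ^ k) (L ^ (d * k)))
    (fun k => iotaActSub P k) (fun k => Submodule.closed_of_finiteDimensional _)
    hQ hQnn hη hη1 (by norm_num) hβ hκ₁ hκ₂ hκ hε hεr hερ
    (div_nonneg (by linarith [secondDiffConst_nonneg (d := d) (fun α => Cα α 1)]) (by positivity)) hbT0 hlT hLq
    h𝒦ε (fun x _ => ⟨hqsymm x, hqT x⟩) (fun x x' hx hx' => hqlip x x' hx hx') ?_ ?_ ?_ ?_ ?_ ?_ ?_ ?_ ?_ ?_ ?_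
  · -- read off the conclusion
    obtain ⟨x₀, hx₀V, hx₀, x, -, htuned, htube, hx0⟩ := hmain
    exact ⟨x₀, hx₀V, hx₀, x, htuned, htube, hx0⟩
  · -- `hT`: Theorem 6.8 for every `q` in the ball
    rintro q ⟨hq, hqT'⟩
    have hS := stepKernelBounds_family_of_torusFRD hd hMord hMR hLodd hL hθbar hlam hn hn2 hnñ hc hC1 hallA hB
      hθ0 hθ hT₀ hKT₀ hq hqT'
    have hT := isRGStepQ_abkm_of_stepKernelBounds (p := pT) (𝒞s := 𝒞s q) hd hLodd hL hR2 hM hp hpM hMR hr₀ hB hδ₀ hδ₁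
      hh hh0 hS hh2 (hA𝒫' ▸ hA𝒫0) hA1 (hA𝒫' ▸ hA𝒫A) (hA𝒫' ▸ hsmall) hr0 hr (hA𝒫' ▸ hv) (hA𝒫' ▸ hωA)
      (hA𝒫' ▸ hc3A) (hA𝒫' ▸ hc2A)
    simp only [rgBT_of_mem (h := h) hd hMord hMR hLodd hL hM hθbar hlam hn hn2 hnñ hc hC1 hallA hB pT r₀ hr₀ A hθ0 hθ
      hT₀ hKT₀ hq hqT']
    rw [← hA𝒫']
    exact hT
  · -- `hy₀`
    intro x hx
    have h2 : Real.exp (1 / 4) ≤ Real.exp (1 / 4) + 2 * Real.exp (3 / 8) := by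
      have := Real.exp_pos (3 / 8 : ℝ); linarith
    have hρ𝒦 : 0 ≤ ρ𝒦 := by
      have h0 := (norm_nonneg _).trans (h𝒦b 0 (Nat.zero_le _) 0)
      exact (mul_nonneg_iff_of_pos_right (Real.exp_pos _)).1 h0
    have h3 : Real.exp (1 / 4) * (ρ𝒦 * Real.exp (fieldWt h (L : ℝ) d 0 / (L : ℝ) ^ 0)) * A ≤
        (Real.exp (1 / 4) + 2 * Real.exp (3 / 8)) * (ρ𝒦 * Real.exp (fieldWt h (L : ℝ) d 0 / (L : ℝ) ^ 0)) * A :=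
      mul_le_mul_of_nonneg_right (mul_le_mul_of_nonneg_right h2 (mul_nonneg hρ𝒦 (Real.exp_pos _).le)) hA0.le
    have h1 : Real.exp (1 / 4) * (ρ𝒦 * Real.exp (fieldWt h (L : ℝ) d 0 / (L : ℝ) ^ 0)) * A ≤ 1 :=
      h3.trans (h𝒦small.trans (by norm_num))
    exact activityNormLE_initAct hd2 hLodd hM (by omega) (by omega) hB hδ₀ hδ₁ hh hh0 hA0 h𝒦 h𝒦b h1 x (hx.trans hρ8)
  · -- `ha`: (12.51)
    rintro q q' ⟨hq, hqT'⟩ ⟨hq', hq'T'⟩ k hk w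
    exact norm_rgA_symm_one_add_sub_le_of_torusFRD (fun A hA => (hallA A hA).2.2.2.2.1) hd2 hn2 hq' hq
      (hq'T'.trans hT₀) (hqT'.trans hT₀) (by omega) w
  · -- `hb`: (12.52)
    rintro q q' ⟨hq, hqT'⟩ ⟨hq', hq'T'⟩ k hk v cv hv
    simp only [rgBT_of_mem (h := h) hd hMord hMR hLodd hL hM hθbar hlam hn hn2 hnñ hc hC1 hallA hB pT r₀ hr₀ A hθ0
      hθ hT₀ hKT₀ hq hqT', rgBT_of_mem (h := h) hd hMord hMR hLodd hL hM hθbar hlam hn hn2 hnñ hc hC1 hallA hB pT r₀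
      hr₀ A hθ0 hθ hT₀ hKT₀ hq' hq'T']
    exact hbT q' q hq' hq hq'T' hqT' k (by omega) v cv hv
  · -- `hl`: (12.53), the hypothesis
    rintro q q' ⟨hq, hqT'⟩ ⟨hq', hq'T'⟩ k hk u v cv hu hv hcv
    exact hl q q' hq hq' hqT' hq'T' k (by omega) u v cv hu hv hcv
  · -- `hm`: Lemma 12.2
    intro x x' hx hx'
    exact activityNormLE_initAct_sub hd2 hLodd hM (by omega) (by omega) hB hδ₀ hδ₁ hh hh0 hA0 h𝒦 h𝒦b h𝒦small
      x x' (hx.trans hρ16) (hx'.trans hρ16)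
  · -- `A_k` preserves the `ι`-symmetric Hamiltonians
    intro q _ k x hx
    show IsIotaHam (HamSpace.toHam (rgA L h (𝒞s q) k x))
    unfold rgA
    rw [toHam_stepOpAEquiv]
    exact isIotaHam_stepOpA _ hx
  · -- `A_k⁻¹` preserves them
    intro q _ k x hx
    show IsIotaHam (HamSpace.toHam ((rgA L h (𝒞s q) k).symm x))
    unfold rgA
    rw [toHam_stepOpAEquiv_symm]
    exact isIotaHam_stepOpAInv _ hx
  · -- `B_k` maps `ι`-symmetric activities to `ι`-symmetric Hamiltonians
    rintro q ⟨hq, hqT'⟩ k hk y hy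
    have hk' : k + 1 ≤ N := hk
    have hS := stepKernelBounds_family_of_torusFRD hd hMord hMR hLodd hL hθbar hlam hn hn2 hnñ hc hC1 hallA hB
      hθ0 hθ hT₀ hKT₀ hq hqT'
    show IsIotaHam (HamSpace.toHam (rgBT hd hMord hMR hLodd hL hM hθbar hlam hn hn2 hnñ hc hC1 hallA hB pT r₀ hr₀ A hθ0 hθ
      hT₀ hKT₀ q k y))
    rw [rgBT_of_mem (h := h) hd hMord hMR hLodd hL hM hθbar hlam hn hn2 hnñ hc hC1 hallA hB pT r₀ hr₀ A hθ0 hθ hT₀ hKT₀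
      hq hqT']
    unfold rgBQ
    rw [dif_pos hk']
    show IsIotaHam (HamSpace.toHam (HamSpace.ofHam (opBHomQ (p := pT) (A := A) hB (by omega) hLodd hM
      (abkmStepData L R k (𝒞s q)) (hS k hk') (x₀ := 0) rfl y)))
    rw [HamSpace.toHam_ofHam, opBHomQ_apply]
    obtain ⟨C, hyC⟩ := activitySpace.exists_weakNormLE y
    have hMo : Odd M := by rw [hM]; exact hLodd.pow
    have hMt : M = P.L ^ k * L ^ (N - k) := by
      show M = L ^ k * L ^ (N - k)
      rw [hM, ← pow_add, Nat.add_sub_cancel' (by omega)]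
    have hC0 : 0 ≤ C := nonneg_of_weakNormLE hPA hMt hLodd.pow hLodd.pow hyC
    have hK2 : ContDiff ℝ 2 (fluct (abkmStepData L R k (𝒞s q)).𝒞
        ((y : Finset (Fin d → ZMod M) → ((Fin d → ZMod M) → ℝ) → ℂ) (abkmStepData L R k (𝒞s q)).B₀)) :=
      (contDiff_fluct_of_weakNormLE_of_stepKernelBounds hB (hS k hk') hA0 hC0 hyC (activitySpace.contDiff y)
        (fun X hX hXc => activitySpace.isGaugeLocal y hX hXc) (isPolymer_blockOf _ _)
        (isConn_blockOf hMo hLodd.pow 0)).of_le (by norm_cast; omega)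
    unfold opB
    rw [neg_eq_zero_sub]
    exact isIotaHam_zero.sub (isIotaHam_Pi2 hK2 (iota_fluct (hS k hk').posSemidef (fun φ => hy _ φ)) _ _)
  · -- `S_k` maps `ι`-symmetric data to `ι`-symmetric activities
    rintro q ⟨hq, hqT'⟩ k hk x y hx hy
    have hk' : k + 1 ≤ N := hk
    have hS := stepKernelBounds_family_of_torusFRD hd hMord hMR hLodd hL hθbar hlam hn hn2 hnñ hc hC1 hallA hB
      hθ0 hθ hT₀ hKT₀ hq hqT'
    show IsIotaFun (((rgSQ (L := L) (N := N) (Mord := Mord) (R := R) (p := pT) (r₀ := r₀) (h := h) (θbar := θbar)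
      (A := A) (δ₀ := δ₀) (δ₁ := δ₁) (𝒞 := fun j => 𝒞 1 j) (𝒞s q) k x y : activitySpace P (k + 1)) :
        Finset (Fin d → ZMod M) → ((Fin d → ZMod M) → ℝ) → ℂ))
    unfold rgSQ
    split_ifs with hmem
    · show IsIotaFun (restrictConn (L ^ (k + 1)) (nextKStep (abkmStepData L R k (𝒞s q)) (HamSpace.toHam x)
        (mulExt ((y : activitySpace P k) : Finset (Fin d → ZMod M) → ((Fin d → ZMod M) → ℝ) → ℂ))))
      obtain ⟨C, hyC⟩ := activitySpace.exists_weakNormLE y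
      have hMo : Odd M := by rw [hM]; exact hLodd.pow
      have hMt : M = P.L ^ k * L ^ (N - k) := by
        show M = L ^ k * L ^ (N - k)
        rw [hM, ← pow_add, Nat.add_sub_cancel' (by omega)]
      have hC0 : 0 ≤ C := nonneg_of_weakNormLE hPA hMt hLodd.pow hLodd.pow hyC
      have hKmul : IsIotaFun (mulExt ((y : activitySpace P k) : Finset (Fin d → ZMod M) → ((Fin d → ZMod M) → ℝ) → ℂ)) :=
        isIotaFun_mulExt hy
      have hH2 : ContDiff ℝ 2 (fluct (abkmStepData L R k (𝒞s q)).𝒞 (eval (HamSpace.toHam x) (abkmStepData L R k (𝒞s q)).B₀)) := by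
        have hfun : fluct (abkmStepData L R k (𝒞s q)).𝒞 (eval (HamSpace.toHam x) (abkmStepData L R k (𝒞s q)).B₀) =
            fun φ => eval (stepOpA (gradCov (abkmStepData L R k (𝒞s q)).𝒞) (HamSpace.toHam x))
              (abkmStepData L R k (𝒞s q)).B₀ φ := by
          funext φ; exact fluct_eval (hS k hk').posSemidef _ _ φ
        rw [hfun]; exact contDiff_eval _ _
      have hK2 : ContDiff ℝ 2 (fluct (abkmStepData L R k (𝒞s q)).𝒞
          (mulExt ((y : activitySpace P k) : Finset (Fin d → ZMod M) → ((Fin d → ZMod M) → ℝ) → ℂ)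
            (abkmStepData L R k (𝒞s q)).B₀)) :=
        (contDiff_fluct_of_weakNormLE_of_stepKernelBounds hB (hS k hk') hA0 hC0 (activitySpace.weakNormLE_mulExt y hyC)
          (activitySpace.contDiff_mulExt y) (fun X hX hXc => activitySpace.isGaugeLocal_mulExt y hX hXc)
          (isPolymer_blockOf _ _) (isConn_blockOf hMo hLodd.pow 0)).of_le (by norm_cast; omega)
      exact isIotaFun_restrictConn (isIotaFun_nextKStep _ (hS k hk').posSemidef hx hKmul hH2 hK2)
    · intro X φ
      simp
  · -- the initial activity `K̂_0(𝒦, ℋ)` is `ι`-symmetric for an `ι`-Hamiltonian `ℋ`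
    intro x _ hx
    show IsIotaFun (((initAct (N := N) (Mord := Mord) (R := R) (p := pT) (r₀ := r₀) (θbar := θbar) (A := A) (δ₀ := δ₀)
      (δ₁ := δ₁) (𝒞 := fun j => 𝒞 1 j) 𝒦 x : activitySpace P 0) : Finset (Fin d → ZMod M) → ((Fin d → ZMod M) → ℝ) → ℂ))
    unfold initAct
    split_ifs with hmem
    · show IsIotaFun (restrictConn (L ^ 0) (initKH 𝒦 (HamSpace.toHam x)))
      refine isIotaFun_restrictConn fun X φ => ?_
      rw [initKH_apply, initKH_apply, map_mul, IsIotaHam.isIotaFun_expNegH hx X φ, initK_neg_of_conj 𝒦 h𝒦ι]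
    · intro X φ
      simp

end Package

end Summit.HubbardSuperconductivity.HubbardSuperconductivity.Theorems.ComplexGFF

end
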